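import Literature.Probability.Percolation.SlabCircuitHullCrossing
import Literature.Probability.Percolation.SlabCircuitTheorem310Uniform
import Literature.Probability.Percolation.SlabRSWProp39TwoHighProb
import Literature.Probability.Percolation.SlabRSWSegmentSqrtTrick
import Literature.Probability.Percolation.SlabRSWProp39HighProb
import Literature.Probability.Percolation.DeletionTolerance
import HarnessLib

/-!
# Newman–Tassion–Wu 2017, Theorem 3.17 (arXiv) = Theorem 3.19 (CPAM): the RSW theorem in the
# high-probability regime, via the circuit gluing layer

Topic: `Literature/Probability/Percolation`.  NTW's Theorem 3.17: for `p ∈ [ε, 1-ε]`,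
`sup_n f_p(n,2n) = 1 ⟹ sup_n f_p(2n,n) = 1`.  NTW's proof uses the conclusion `inf_n f(2n,n) > 0` of their
RSW Theorem 3.14/3.16 (arXiv (3.56): circuits in annuli with probability `≥ c₀`); here that input is the
explicit hypothesis `hlow : ∃ c₀ > 0, ∃ n₁, ∀ n ≥ n₁, f_p(2n, n-1) ≥ c₀`, turned into circuits by the tree's
Theorem 3.10 (`h310_holds_uniform`) and amplified in `ℓ` dyadic annuli (`real_circuitAround_amplify`).
The gluing steps (NTW: "an adaptation of the Theorem 3.8 gluing lemma", Fig. 3.6) are done with the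
CIRCUIT gluing lemma (`hullCrossing_highProb`, `SlabCircuitHullCrossing.lean`): the right side of
`R = [1,1+w]×[0,M-1]` and the left side of its mirror image `R'` are both glued, inside the hull
`W = [-1-w, 1+w] × [-c₁s, M-1+c₁s]`, to the minimal open circuit of ONE annulus `A_{s, c₁ s}((0,y))` around the
segment `{1}×[y, y+s-1]` given by the square-root trick (`real_leftSeg_right_ge`); a final application of
Proposition 3.9 (1) in the high-probability regime (`tb_extend_highProb`) doubles the aspect ratio.
(We use a rectangle `R` of aspect ratio `8 : 10` — three applications of Proposition 3.9 (2) to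
`f(n,2n)` — instead of NTW's `3 : 4` with the extra up-down symmetry, so that the hull is already a hard
crossing of aspect ratio `> 3/2`.)

* `crossingProb_lt_one` — `f_p(n,m) < 1` for `p < 1`, `n ≥ 1`; `exists_large_of_sup_eq_one` — under
  `sup_n f_p(n,2n) = 1` the good scales are unbounded.
* **`rsw_highProb`** — ∀ `k ≥ 1`, `ε > 0`, `m₀ ≥ 52`, `p ∈ [ε,1-ε]` with `hlow`: for every `η > 0`,
  `(∀ δ > 0 ∃ n ≥ 1, f_p(n,2n) ≥ 1-δ) ⟹ ∃ n ≥ m₀, f_p(2n, n-1) ≥ 1-η`.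

## Sources

* C. M. Newman, V. Tassion, W. Wu, *Critical percolation and the minimal spanning tree in slabs*,
  Comm. Pure Appl. Math. 70 (2017) = arXiv:1512.09107: Theorem 3.17 and its proof (§3.6, (3.53)–(3.58),
  Fig. 3.6) [NewmanTassionWu2017].
-/

noncomputable section

namespace Literature.Probability.Percolation

open MeasureTheory LatticeModels SimpleGraph

namespace NTW17

variable {k : ℕ}

/-! ## Good scales are unbounded -/

/-- **`f_p(n, m) < 1`** for `p < 1` and `n ≥ 1`: with positive probability every edge of the box is closed,
and then there is no open left-right crossing. [cite: NewmanTassionWu2017, §3.7 ((3.60): sup f(n,2n) < 1)] -/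
theorem crossingProb_lt_one {p : unitInterval} (hp : (p : ℝ) < 1) {n : ℕ} (hn : 1 ≤ n) (m : ℕ) :
    crossingProb k p n m < 1 := by
  classical
  rw [crossingProb_eq]
  set P := bondPercolation (slabGraph 3 k) p with hP
  set E := slabConn k (boxR 0 n 0 m) {z | z.1 = 0} {z | z.1 = (n : ℤ)} with hE
  have hEm : MeasurableSet E := measurableSet_slabConn_boxR _ _ _ _ _ _
  have hfin : (slabLift k (boxR 0 (n : ℤ) 0 m)).Finite := slabLift_finite k (boxR_finite _ _ _ _)
  set F : Finset (Sym2 (slab 3 k)) := (finite_sym2 hfin).toFinset with hF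
  have hpos : 0 < P.real Eᶜ := by
    refine bondPercolation_real_pos_of_closeEdges (slabGraph 3 k) hp F hEm.compl (A := Set.univ)
      (by rw [probReal_univ]; exact one_pos) fun ω _ => ?_
    rw [Set.mem_compl_iff]
    intro h
    obtain ⟨l, hl⟩ := (mem_slabConn_iff_exists_isOSAP _ _ _ _).1 h
    obtain ⟨a, l', hla⟩ := List.exists_cons_of_ne_nil hl.ne_nil
    have hhead := hl.head_mem hl.ne_nil
    have hlast := hl.last_mem hl.ne_nil
    rw [mem_slabLift_iff, Set.mem_setOf_eq] at hhead hlast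
    subst hla
    cases l' with
    | nil =>
      simp only [List.head_cons, List.getLast_singleton] at hhead hlast
      omega
    | cons b l'' =>
      have hab := (List.isChain_cons_cons.1 hl.chain).1
      have ha : a ∈ slabLift k (boxR 0 (n : ℤ) 0 m) := hl.subset a (by simp)
      have hb : b ∈ slabLift k (boxR 0 (n : ℤ) 0 m) := hl.subset b (by simp)
      have hmem : s(a, b) ∈ (F : Set (Sym2 (slab 3 k))) := by
        rw [hF, Set.Finite.coe_toFinset]; exact Set.mk_mem_sym2_iff.2 ⟨ha, hb⟩
      exact (notMem_closeEdges_of_mem ω hmem) hab.1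
  have := probReal_compl_eq_one_sub (μ := P) hEm
  linarith

/-- **Under `sup_n f_p(n,2n) = 1` the good scales are unbounded** (`p < 1`): for every `δ > 0` and `n₁`
there is `n ≥ n₁` with `f_p(n,2n) ≥ 1-δ`. [cite: NewmanTassionWu2017, §3.6 (proof of Theorem 3.17: "we can find an n such that (3.55)")] -/
theorem exists_large_of_sup_eq_one {p : unitInterval} (hp : (p : ℝ) < 1)
    (h : ∀ δ : ℝ, 0 < δ → ∃ n : ℕ, 1 ≤ n ∧ 1 - δ ≤ crossingProb k p n (2 * n)) {δ : ℝ} (hδ : 0 < δ)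
    (n₁ : ℕ) : ∃ n : ℕ, n₁ ≤ n ∧ 1 - δ ≤ crossingProb k p n (2 * n) := by
  classical
  obtain ⟨n₀, hn₀, hmin⟩ := Finset.exists_min_image (Finset.range (n₁ + 1))
    (fun n => 1 - crossingProb k p (n + 1) (2 * (n + 1))) ⟨0, by simp⟩
  set g : ℝ := 1 - crossingProb k p (n₀ + 1) (2 * (n₀ + 1)) with hg
  have hgpos : 0 < g := by
    have := crossingProb_lt_one (k := k) hp (show 1 ≤ n₀ + 1 by omega) (2 * (n₀ + 1))
    rw [hg]; linarith
  obtain ⟨n, hn1, hn⟩ := h (min δ (g / 2)) (lt_min hδ (half_pos hgpos))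
  refine ⟨n, ?_, (sub_le_sub_left (min_le_left δ (g / 2)) 1).trans hn⟩
  by_contra hlt
  push Not at hlt
  have hmem : n - 1 ∈ Finset.range (n₁ + 1) := by simp; omega
  have h1 := hmin (n - 1) hmem
  have h2 : n - 1 + 1 = n := by omega
  simp only [h2] at h1
  have h4 : min δ (g / 2) ≤ g / 2 := min_le_right _ _
  linarith

/-! ## Reflected rectangles -/

/-- `x ↦ -x` maps `[a,b]×[c,d]` onto `[-b,-a]×[c,d]`. [folklore] -/
private theorem image_planarReflect_zero_boxR (a b c d : ℤ) :
    planarReflect 0 '' boxR a b c d = boxR (-b) (-a) c d := by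
  rw [image_planarReflect_eq]
  ext z
  simp only [Set.mem_setOf_eq, mem_boxR_iff]
  omega

/-- A side segment lies on its line. [folklore] -/
private theorem sideSeg_subset_line (x s t : ℤ) : sideSeg x s t ⊆ {z : ℤ × ℤ | z.1 = x} := fun _ hz => hz.1

/-- `X ⟷^S {x = b}` inside `S = [a,b]×[c,d]` ends on the right SIDE `{b}×[c,d]`. [folklore] -/
private theorem slabConn_line_subset_sideSeg (a b c d : ℤ) (X : Set (ℤ × ℤ)) :
    slabConn k (boxR a b c d) X {z | z.1 = b} ⊆ slabConn k (boxR a b c d) X (sideSeg b c d) := by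
  rintro ω ⟨x, hx, y, hy, hxy⟩
  have hyS : y ∈ slabLift k (boxR a b c d) := (DCT16.pathIn_of_mem_openConnIn hxy).right_mem
  rw [mem_slabLift_iff, mem_boxR_iff] at hyS
  rw [mem_slabLift_iff, Set.mem_setOf_eq] at hy
  exact ⟨x, hx, y, by rw [mem_slabLift_iff]; exact ⟨hy, hyS.2.2.1, hyS.2.2.2⟩, hxy⟩

/-! ## Theorem 3.17 -/

/-- **NTW 2017, Theorem 3.17 (arXiv) = 3.19 (CPAM), RSW in the high-probability regime** — with NTW's
input (3.56) (circuits, from `inf f(2n,n) > 0`) replaced by the explicit lower bound `hlow` fed through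
Theorem 3.10: for `k ≥ 1`, `ε > 0`, `m₀ ≥ 52`, `p ∈ [ε, 1-ε]` with `f_p(2n,n-1) ≥ c₀ > 0` for all large `n`,
and every `η > 0`: if `f_p(n, 2n) ≥ 1-δ` has a solution `n ≥ 1` for every `δ > 0`, then
`f_p(2n, n-1) ≥ 1-η` for some `n ≥ m₀`. [cite: NewmanTassionWu2017, Theorem 3.17 (proof: §3.6, (3.53)–(3.58), Fig. 3.6)] -/
theorem rsw_highProb (hk : 1 ≤ k) {ε : ℝ} (hε : 0 < ε) {m₀ : ℕ} (hm₀ : 52 ≤ m₀) (p : unitInterval)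
    (hpε : ε ≤ (p : ℝ)) (hp1 : (p : ℝ) ≤ 1 - ε)
    (hlow : ∃ c₀ : ℝ, 0 < c₀ ∧ ∃ n₁ : ℕ, ∀ n : ℕ, n₁ ≤ n → c₀ ≤ crossingProb k p (2 * n) (n - 1))
    {η : ℝ} (hη : 0 < η)
    (hsup : ∀ δ : ℝ, 0 < δ → ∃ n : ℕ, 1 ≤ n ∧ 1 - δ ≤ crossingProb k p n (2 * n)) :
    ∃ n : ℕ, m₀ ≤ n ∧ 1 - η ≤ crossingProb k p (2 * n) (n - 1) := by
  classical
  have hp1' : (p : ℝ) < 1 := by linarith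
  set P := bondPercolation (slabGraph 3 k) p with hP
  -- (a) the final width extension (Proposition 3.9 (1), high-probability regime)
  obtain ⟨δA, hδA, HA⟩ := tb_extend_highProb k 2 hk le_rfl hε hη
  -- (b) the hull crossing from two side-to-circuit gluings
  obtain ⟨δB, hδB, HB⟩ := hullCrossing_highProb k hε hδA
  -- (c) circuits in annuli (Theorem 3.10) and their amplification constant `c₁ = λ 2^ℓ`
  obtain ⟨c₀, hc₀, n₁, hlow⟩ := hlow
  obtain ⟨lam, hlam, c', hc', H310⟩ := h310_holds_uniform hk hm₀ ε hε c₀ hc₀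
  obtain ⟨ℓ, hℓ⟩ := exists_pow_lt_of_lt_one hδB (show 1 - c' < 1 by linarith)
  obtain ⟨c₁, hc₁def⟩ : ∃ c₁ : ℕ, c₁ = lam * 2 ^ ℓ := ⟨_, rfl⟩
  have hc₁1 : 1 ≤ c₁ := by
    rw [hc₁def]; exact le_trans hlam (Nat.le_mul_of_pos_right _ (by positivity))
  obtain ⟨q, hqdef⟩ : ∃ q : ℕ, q = 3 * c₁ + 1 := ⟨_, rfl⟩
  have hq0 : 0 < q := by omega
  obtain ⟨L, hLdef⟩ : ∃ L : ℕ, L = 10 * q := ⟨_, rfl⟩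
  have hL1 : 1 ≤ L := by omega
  have hL0 : (L : ℝ) ≠ 0 := by positivity
  -- (d) three height reductions (Proposition 3.9 (2)) down to aspect ratio `8 : 9`
  obtain ⟨δ₁, hδ₁, H₁⟩ := crossingProb_height_reduce_highProb (pow_pos hδB L)
  obtain ⟨δ₂, hδ₂, H₂⟩ := crossingProb_height_reduce_highProb hδ₁
  obtain ⟨δ₃, hδ₃, H₃⟩ := crossingProb_height_reduce_highProb hδ₂
  -- (e) the scale: `n₀` good for `δ₃`, `t = n₀ / 8`, `s = t / q ≥ S₁`
  set S₁ : ℕ := max (max m₀ n₁) 16 with hS₁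
  obtain ⟨n₀, hn₀, hf₀⟩ := exists_large_of_sup_eq_one hp1' hsup hδ₃ (8 * (q * S₁) + 8)
  obtain ⟨t, htdef⟩ : ∃ t : ℕ, t = n₀ / 8 := ⟨_, rfl⟩
  have ht1 : 8 * t ≤ n₀ := by omega
  have ht2 : n₀ < 8 * t + 8 := by omega
  have ht3 : q * S₁ + 1 ≤ t := by omega
  obtain ⟨s, hsdef⟩ : ∃ s : ℕ, s = t / q := ⟨_, rfl⟩
  have hs1 : q * s ≤ t := by rw [hsdef]; exact Nat.mul_div_le t q
  have hs2 : t < q * s + q := by rw [hsdef, mul_comm]; exact Nat.lt_div_mul_add hq0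
  have hs3 : S₁ ≤ s := by
    rw [hsdef]; refine (Nat.le_div_iff_mul_le hq0).2 ?_; rw [mul_comm]; omega
  have hsm₀ : m₀ ≤ s := le_trans (le_trans (le_max_left _ _) (le_max_left _ _)) hs3
  have hsn₁ : n₁ ≤ s := le_trans (le_trans (le_max_right _ _) (le_max_left _ _)) hs3
  have hs16 : 16 ≤ s := le_trans (le_max_right _ _) hs3
  clear hsdef htdef hs3
  -- atoms: `A = c₁ s` (outer radius), `B = q s`, `w = 8B` (width of `R`), `M = L s` (`R` has `M` rows), `N` (hull height)
  obtain ⟨A, hAdef⟩ : ∃ A : ℕ, A = c₁ * s := ⟨_, rfl⟩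
  obtain ⟨B, hBdef⟩ : ∃ B : ℕ, B = q * s := ⟨_, rfl⟩
  obtain ⟨M, hMdef⟩ : ∃ M : ℕ, M = L * s := ⟨_, rfl⟩
  have hBA : B = 3 * A + s := by rw [hBdef, hAdef, hqdef]; ring
  have hMB : M = 10 * B := by rw [hMdef, hBdef, hLdef]; ring
  have hAs : s ≤ A := by rw [hAdef]; exact Nat.le_mul_of_pos_left _ (by omega)
  have hB9 : 9 * q ≤ B := by rw [hBdef, mul_comm]; exact Nat.mul_le_mul_left _ (by omega)
  obtain ⟨w, hwdef⟩ : ∃ w : ℕ, w = 8 * B := ⟨_, rfl⟩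
  obtain ⟨N, hNdef⟩ : ∃ N : ℕ, N = M - 1 + 2 * A := ⟨_, rfl⟩
  have hMz : ((M : ℕ) : ℤ) = (L : ℤ) * (s : ℤ) := by rw [hMdef]; push_cast; ring
  -- (f) `f(w, M-1) ≥ 1 - δB^L`
  have hf1 : 1 - δ₃ ≤ crossingProb k p (8 * t) (8 * t + (4 * t + 8) + (4 * t + 8)) :=
    hf₀.trans (crossingProb_mono p ht1 (by omega))
  have hf2 := H₃ k p (8 * t) (4 * t + 8) (4 * t + 8) le_rfl hf1
  have hf3 := H₂ k p (8 * t) (2 * t + 4) (2 * t + 4) le_rfl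
    (by rwa [show 8 * t + (2 * t + 4) + (2 * t + 4) = 8 * t + (4 * t + 8) by ring])
  have hf4 := H₁ k p (8 * t) (t + 2) (t + 2) le_rfl
    (by rwa [show 8 * t + (t + 2) + (t + 2) = 8 * t + (2 * t + 4) by ring])
  have hf5 : 1 - δB ^ L ≤ crossingProb k p w (M - 1) :=
    hf4.trans (crossingProb_mono p (by omega) (by omega))
  -- (g) the square-root trick over the `L` segments of the left side of `R = [1,1+w]×[0,M-1]`
  obtain ⟨j, hjL, hseg⟩ := real_leftSeg_right_ge (k := k) (1 : ℤ) (1 + w) 0 (s - 1) L hL1 p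
  have ecast : ((s - 1 : ℕ) : ℤ) = (s : ℤ) - 1 := by omega
  have eR : boxR (1 : ℤ) (1 + (w : ℤ)) 0 (0 + (L : ℤ) * (((s - 1 : ℕ) : ℤ) + 1) - 1) = boxR 1 (1 + (w : ℤ)) 0 ((M : ℤ) - 1) := by
    rw [ecast, hMz]; congr 1; ring
  set y₀ : ℤ := (j : ℤ) * s with hy₀
  have eSeg : sideSeg (1 : ℤ) (0 + (j : ℤ) * (((s - 1 : ℕ) : ℤ) + 1)) (0 + (j : ℤ) * (((s - 1 : ℕ) : ℤ) + 1) + ((s - 1 : ℕ) : ℤ)) =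
      sideSeg 1 y₀ (y₀ + s - 1) := by
    rw [ecast, hy₀]; congr 1 <;> ring
  rw [eR, eSeg] at hseg
  have hy₀0 : 0 ≤ y₀ := by rw [hy₀]; positivity
  have hy₀M : y₀ + s ≤ M := by
    rw [hy₀, hMz]
    have : ((j : ℤ) + 1) * s ≤ (L : ℤ) * s :=
      mul_le_mul_of_nonneg_right (by exact_mod_cast hjL) (by positivity)
    linarith
  -- `F = f(w, M-1)`
  have hF : (bondPercolation (slabGraph 3 k) p).real
      (slabConn k (boxR 1 (1 + (w : ℤ)) 0 ((M : ℤ) - 1)) {z | z.1 = 1} {z | z.1 = 1 + (w : ℤ)}) =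
      crossingProb k p w (M - 1) := by
    rw [crossingProb_eq, ← real_lr_shift ((1 : ℤ), (0 : ℤ)) 0 (w : ℤ) 0 ((M - 1 : ℕ) : ℤ) p]
    have eB : boxR (0 + ((1 : ℤ), (0 : ℤ)).1) ((w : ℤ) + ((1 : ℤ), (0 : ℤ)).1) (0 + ((1 : ℤ), (0 : ℤ)).2)
        (((M - 1 : ℕ) : ℤ) + ((1 : ℤ), (0 : ℤ)).2) = boxR 1 (1 + (w : ℤ)) 0 ((M : ℤ) - 1) := by
      ext z; simp only [mem_boxR_iff]; omega
    have eX : {z : ℤ × ℤ | z.1 = 0 + ((1 : ℤ), (0 : ℤ)).1} = {z | z.1 = 1} := by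
      ext z; simp only [Set.mem_setOf_eq]; omega
    have eY : {z : ℤ × ℤ | z.1 = (w : ℤ) + ((1 : ℤ), (0 : ℤ)).1} = {z | z.1 = 1 + (w : ℤ)} := by
      ext z; simp only [Set.mem_setOf_eq]; omega
    rw [eB, eX, eY]
  have hseg' : 1 - δB ≤ (bondPercolation (slabGraph 3 k) p).real
      (slabConn k (boxR 1 (1 + (w : ℤ)) 0 ((M : ℤ) - 1)) (sideSeg 1 y₀ (y₀ + s - 1)) {z | z.1 = 1 + (w : ℤ)}) := by
    refine le_trans ?_ hseg
    rw [hF]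
    have h0 : 0 ≤ 1 - crossingProb k p w (M - 1) := by
      have : crossingProb k p w (M - 1) ≤ 1 := by rw [crossingProb_eq]; exact measureReal_le_one
      linarith
    have h1 : (1 - crossingProb k p w (M - 1)) ^ ((L : ℝ)⁻¹) ≤ (δB ^ L) ^ ((L : ℝ)⁻¹) :=
      Real.rpow_le_rpow h0 (by linarith) (by positivity)
    rw [Real.pow_rpow_inv_natCast hδB.le (by positivity)] at h1
    linarith
  -- (h) the data of the hull crossing
  set z₀ : ℤ × ℤ := ((0 : ℤ), y₀) with hz₀
  set W : Set (ℤ × ℤ) := boxR (-1 - (w : ℤ)) (1 + (w : ℤ)) (-(A : ℤ)) ((M : ℤ) - 1 + A) with hW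
  set Rt : Set (ℤ × ℤ) := sideSeg (1 + (w : ℤ)) 0 ((M : ℤ) - 1) with hRt
  set Lf : Set (ℤ × ℤ) := sideSeg (-1 - (w : ℤ)) 0 ((M : ℤ) - 1) with hLf
  set T₁ : Set (ℤ × ℤ) := boxR 1 (1 + (w : ℤ)) 0 ((M : ℤ) - 1) with hT₁
  set T₂ : Set (ℤ × ℤ) := boxR (-1 - (w : ℤ)) (-1) 0 ((M : ℤ) - 1) with hT₂
  set X₁ : Set (ℤ × ℤ) := sideSeg 1 y₀ (y₀ + s - 1) with eX₁
  set X₂ : Set (ℤ × ℤ) := sideSeg (-1) y₀ (y₀ + s - 1) with eX₂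
  have hA1 : (s : ℤ) ≤ A := by exact_mod_cast hAs
  have hwA : (A : ℤ) + 1 ≤ w := by
    have : A + 1 ≤ w := by omega
    exact_mod_cast this
  have hsqA : sqBox z₀ A ⊆ W := by
    intro z hz
    simp only [sqBox, hz₀, Set.mem_setOf_eq, abs_le] at hz
    rw [hW, mem_boxR_iff]
    omega
  have hAW : annulus z₀ s A ⊆ W := (annulus_subset_sqBox _ _ _).trans hsqA
  have hLW : Lf ⊆ W := by
    intro z hz; simp only [hLf, sideSeg, Set.mem_setOf_eq] at hz; rw [hW, mem_boxR_iff]; omega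
  have hRW : Rt ⊆ W := by
    intro z hz; simp only [hRt, sideSeg, Set.mem_setOf_eq] at hz; rw [hW, mem_boxR_iff]; omega
  have hLfar : Disjoint Lf (sqBox z₀ A) := by
    refine Set.disjoint_left.2 fun z hz hz' => ?_
    simp only [hLf, sideSeg, Set.mem_setOf_eq] at hz
    simp only [sqBox, hz₀, Set.mem_setOf_eq, abs_le] at hz'
    omega
  have hRfar : Disjoint Rt (sqBox z₀ A) := by
    refine Set.disjoint_left.2 fun z hz hz' => ?_
    simp only [hRt, sideSeg, Set.mem_setOf_eq] at hz
    simp only [sqBox, hz₀, Set.mem_setOf_eq, abs_le] at hz'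
    omega
  have hT₁W : T₁ ⊆ W := by
    intro z hz; rw [hT₁, mem_boxR_iff] at hz; rw [hW, mem_boxR_iff]; omega
  have hT₂W : T₂ ⊆ W := by
    intro z hz; rw [hT₂, mem_boxR_iff] at hz; rw [hW, mem_boxR_iff]; omega
  have hs1' : (1 : ℤ) ≤ s := by exact_mod_cast (le_trans (by norm_num) hs16 : 1 ≤ s)
  have hX₁ : X₁ ⊆ sqBox z₀ s := by
    intro z hz
    simp only [eX₁, sideSeg, Set.mem_setOf_eq] at hz
    simp only [sqBox, hz₀, Set.mem_setOf_eq, abs_le]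
    omega
  have hX₂ : X₂ ⊆ sqBox z₀ s := by
    intro z hz
    simp only [eX₂, sideSeg, Set.mem_setOf_eq] at hz
    simp only [sqBox, hz₀, Set.mem_setOf_eq, abs_le]
    omega
  -- (i) the three probabilistic inputs
  have hcirc : 1 - δB ≤ P.real (circuitAround k z₀ s A) := by
    have hamp := real_circuitAround_amplify (k := k) p z₀ (m := s) (lam := lam) (ℓ := ℓ) hlam (c' := c')
      (fun i _ => by
        have hsc : s ≤ 2 ^ i * s := Nat.le_mul_of_pos_left _ (by positivity)
        have := H310 p hpε hp1 (2 ^ i * s) (le_trans hsm₀ hsc) (hlow _ (le_trans hsn₁ hsc)) z₀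
        simpa only [mul_assoc] using this)
    rw [hAdef, hc₁def]
    exact le_trans (by linarith) hamp
  have hC₁ : 1 - δB ≤ P.real (slabConn k T₁ X₁ Rt) :=
    hseg'.trans (measureReal_mono (slabConn_line_subset_sideSeg _ _ _ _ _))
  have hC₂ : 1 - δB ≤ P.real (slabConn k T₂ X₂ Lf) := by
    have himg := real_slabConn_image k (planarReflect 0) (planarAdj_planarReflect 0) p T₁ X₁ Rt
    have i1 : planarReflect 0 '' T₁ = T₂ := by
      rw [hT₁, image_planarReflect_zero_boxR, hT₂]; congr 1; ring
    have i2 : planarReflect 0 '' X₁ = X₂ := by rw [eX₁, image_planarReflect_sideSeg, zero_sub]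
    have i3 : planarReflect 0 '' Rt = Lf := by
      rw [hRt, image_planarReflect_sideSeg, hLf]; congr 1; ring
    rw [i1, i2, i3] at himg
    rw [hP, himg]; exact hC₁
  -- (j) the hull crossing `f(2w+2, N) ≥ 1 - δA`
  have hHull := HB z₀ s A W Lf Rt T₁ T₂ X₁ X₂ (boxR_finite _ _ _ _) hAW hLW hRW hLfar hRfar hT₁W hT₂W
    hX₁ hX₂ p hpε hp1 hcirc hC₁ hC₂
  have hN1 : 1 ≤ M := by omega
  have hNz : ((N : ℕ) : ℤ) = (M : ℤ) - 1 + 2 * A := by omega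
  have hfN : 1 - δA ≤ crossingProb k p (2 * w + 2) N := by
    refine hHull.trans ((measureReal_mono (slabConn_mono_sets subset_rfl (sideSeg_subset_line _ _ _)
      (sideSeg_subset_line _ _ _))).trans (le_of_eq ?_))
    rw [crossingProb_eq, ← real_lr_shift ((-1 - (w : ℤ)), (-(A : ℤ))) 0 ((2 * w + 2 : ℕ) : ℤ) 0 (N : ℤ) p]
    have eB : boxR (0 + ((-1 - (w : ℤ)), (-(A : ℤ))).1) (((2 * w + 2 : ℕ) : ℤ) + ((-1 - (w : ℤ)), (-(A : ℤ))).1)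
        (0 + ((-1 - (w : ℤ)), (-(A : ℤ))).2) ((N : ℤ) + ((-1 - (w : ℤ)), (-(A : ℤ))).2) = W := by
      rw [hW]; ext z; simp only [mem_boxR_iff]; push_cast; omega
    have eX : {z : ℤ × ℤ | z.1 = 0 + ((-1 - (w : ℤ)), (-(A : ℤ))).1} = {z | z.1 = -1 - (w : ℤ)} := by
      ext z; simp only [Set.mem_setOf_eq]; omega
    have eY : {z : ℤ × ℤ | z.1 = ((2 * w + 2 : ℕ) : ℤ) + ((-1 - (w : ℤ)), (-(A : ℤ))).1} = {z | z.1 = 1 + (w : ℤ)} := by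
      ext z; simp only [Set.mem_setOf_eq]; push_cast; omega
    rw [eB, eX, eY]
  -- (k) Proposition 3.9 (1): `f(2N+2, N) ≥ 1 - η`
  have hfin := HA N (N / 2) (2 * w + 2) (2 * N + 2) (by omega) (by omega) (by omega) (by omega) (by omega)
    (by omega) (by omega) p hpε hp1 hfN
  refine ⟨N + 1, by omega, ?_⟩
  rwa [show 2 * (N + 1) = 2 * N + 2 by ring, Nat.add_sub_cancel]

end NTW17

end Literature.Probability.Percolation

end
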